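import Summits.QuantumFields.QCD.Theorems.ExtinctionBuildsQCD.Negative.TightPinsLine

/-!
# Negative knowledge for crux `ExtinctionBuildsQCD` (stmt-QuantumFields-8968), §5a: local inertia
# bounds along an affine Hermitian pencil

Certified copy of §5 (matrix part, first half) of the cdisprove work file
`Summits/QuantumFields/QCD/Cruxes/ExtinctionBuildsQCD/Disproof.lean` (refuter, cdisprove seat,
cycle 2). Supports stmt-QuantumFields-8968; asserts no route item. Pure finite-dimensional linear
algebra over `ℂ` (any finite index type), feeding `CrossingBudget.lean` and `IndexBudget.lean`.

* `negRootCount` / `posRootCount` / `zeroRootCount`: roots of the characteristic polynomial with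
  negative / positive / zero real part, with multiplicity (the count inside TIGHT is `negRootCount`);
  for Hermitian matrices these are the numbers of negative / positive / zero eigenvalues
  (`*_eq_card`), and `neg + pos + zero = card`.
* `negRootCount_local`: for Hermitian `A`, `Γ` with `|Re⟨v, Γv⟩| ≤ ‖v‖²`, along `H(t) = A + tΓ`, near
  every `s`: `n₋(H s) ≤ n₋(H t) ≤ n₋(H s) + n₀(H s)` for `|t - s| < r(s)` (`r(s)` = least non-zero
  `|eigenvalue|` of `H(s)`). Proof: Sylvester's law of inertia (`card_le_card_eigenvalues_of_form_pos`,
  `ChiralInertia.lean`) on the images of the negative and of the positive eigenspace of `H(s)`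
  (`extendByZero` + the eigenvector unitary), where the form of `H(t)` keeps its sign; no eigenvalue
  perturbation theory is used.
* `zeroRootCount_le_count`: with `Γ² = 1`, `n₀(A + sΓ) ≤ mult_{-s}(charpoly(ΓA))` (rank-nullity for
  `ΓA + s`, and geometric ≤ algebraic multiplicity, Mathlib `LinearMap.finrank_eigenspace_le`).

References: Horn–Johnson, *Matrix Analysis* (1985), Thm. 4.5.8 (Sylvester's law of inertia);
Edwards–Heller–Narayanan, Nucl. Phys. B 535 (1998) 403, §2 (the Hermitian Wilson pencil `H_W(m)`).
-/

noncomputable section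

namespace Summit.QuantumFields.QCD.Theorems.ExtinctionBuildsQCD.Negative

open scoped BigOperators Topology Classical MeasureTheory Matrix ComplexConjugate
open Filter MeasureTheory Matrix
open Literature.MathematicalPhysics.QuantumLattice Literature.MathematicalPhysics.QuantumFieldTheory
  Literature.Probability.LatticeModels
open Summit.QuantumFields.QCD.Theses.SpectralDefectExtinction

section IndexBudgetMatrix

variable {n : Type*}

/-- Extension by zero from the coordinates singled out by a predicate. -/
def extendByZero (p : n → Prop) [DecidablePred p] : ({i // p i} → ℂ) →ₗ[ℂ] (n → ℂ) where
  toFun c i := if h : p i then c ⟨i, h⟩ else 0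
  map_add' c d := by
    funext i
    simp only [Pi.add_apply]
    split_ifs <;> simp
  map_smul' a c := by
    funext i
    simp only [Pi.smul_apply, smul_eq_mul, RingHom.id_apply]
    split_ifs <;> simp

/-- Pointwise formula for `extendByZero`. -/
theorem extendByZero_apply (p : n → Prop) [DecidablePred p] (c : {i // p i} → ℂ) (i : n) :
    extendByZero p c i = if h : p i then c ⟨i, h⟩ else 0 := rfl

/-- `extendByZero` on a selected coordinate. -/
theorem extendByZero_apply_of_pos {p : n → Prop} [DecidablePred p] (c : {i // p i} → ℂ) {i : n}
    (hi : p i) : extendByZero p c i = c ⟨i, hi⟩ := by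
  rw [extendByZero_apply, dif_pos hi]

/-- `extendByZero` vanishes off the selected coordinates. -/
theorem extendByZero_apply_of_neg {p : n → Prop} [DecidablePred p] (c : {i // p i} → ℂ) {i : n}
    (hi : ¬ p i) : extendByZero p c i = 0 := by
  rw [extendByZero_apply, dif_neg hi]

/-- Extension by zero is injective. -/
theorem extendByZero_ne_zero {p : n → Prop} [DecidablePred p] {c : {i // p i} → ℂ} (hc : c ≠ 0) :
    extendByZero p c ≠ 0 := by
  intro h
  apply hc
  funext ⟨i, hi⟩
  have := congrFun h i
  rwa [extendByZero_apply_of_pos c hi] at this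

/-- `Σ_i ‖ext c i‖² = Σ_j ‖c j‖²`. -/
theorem sum_norm_sq_extendByZero [Fintype n] (p : n → Prop) [DecidablePred p] (c : {i // p i} → ℂ) :
    ∑ i, ‖extendByZero p c i‖ ^ 2 = ∑ j, ‖c j‖ ^ 2 := by
  have h1 : ∑ i, ‖extendByZero p c i‖ ^ 2 =
      ∑ i ∈ Finset.univ.filter p, ‖extendByZero p c i‖ ^ 2 := by
    rw [Finset.sum_filter]
    refine Finset.sum_congr rfl fun i _ => ?_
    split_ifs with hi
    · rfl
    · rw [extendByZero_apply_of_neg c hi, norm_zero]; simp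
  rw [h1, Finset.sum_subtype (Finset.univ.filter p) (p := p) (fun i => by simp)]
  refine Finset.sum_congr rfl fun j _ => ?_
  rw [extendByZero_apply_of_pos c j.2]

/-- A real multiple of a Hermitian matrix added to a Hermitian matrix is Hermitian. -/
theorem isHermitian_add_real_smul {A Γ : Matrix n n ℂ} (hA : A.IsHermitian) (hΓ : Γ.IsHermitian)
    (t : ℝ) : (A + ((t : ℝ) : ℂ) • Γ).IsHermitian := by
  unfold Matrix.IsHermitian at *
  rw [conjTranspose_add, conjTranspose_smul, hA, hΓ, Complex.star_def, Complex.conj_ofReal]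

variable [Fintype n] [DecidableEq n]

/-- A unitary matrix preserves `Σ ‖v i‖²`. -/
theorem sum_norm_sq_mulVec_of_mem_unitaryGroup {U : Matrix n n ℂ} (hU : U ∈ Matrix.unitaryGroup n ℂ)
    (w : n → ℂ) : ∑ i, ‖(U *ᵥ w) i‖ ^ 2 = ∑ i, ‖w i‖ ^ 2 := by
  have hUU : Uᴴ * U = 1 := by
    have := Matrix.mem_unitaryGroup_iff'.1 hU
    simpa [Matrix.star_eq_conjTranspose] using this
  rw [← re_star_dotProduct_self, ← re_star_dotProduct_self, star_mulVec, ← dotProduct_mulVec,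
    mulVec_mulVec, hUU, one_mulVec]

/-- `Uᴴ (U w) = w` for a unitary matrix. -/
theorem conjTranspose_mulVec_mulVec_of_mem_unitaryGroup {U : Matrix n n ℂ}
    (hU : U ∈ Matrix.unitaryGroup n ℂ) (w : n → ℂ) : Uᴴ *ᵥ (U *ᵥ w) = w := by
  have hUU : Uᴴ * U = 1 := by
    have := Matrix.mem_unitaryGroup_iff'.1 hU
    simpa [Matrix.star_eq_conjTranspose] using this
  rw [mulVec_mulVec, hUU, one_mulVec]

/-- Negative-eigenvalue count of a matrix, as in TIGHT: roots of the characteristic polynomial with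
negative real part, with multiplicity. -/
def negRootCount (M : Matrix n n ℂ) : ℕ := M.charpoly.roots.countP fun z => z.re < 0

/-- Positive-eigenvalue count (roots with positive real part, with multiplicity). -/
def posRootCount (M : Matrix n n ℂ) : ℕ := M.charpoly.roots.countP fun z => 0 < z.re

/-- Zero-eigenvalue count (multiplicity of the root `0` of the characteristic polynomial). -/
def zeroRootCount (M : Matrix n n ℂ) : ℕ := M.charpoly.roots.countP fun z => z = 0

/-- For a Hermitian matrix the negative root count is the number of negative eigenvalues. -/
theorem negRootCount_eq_card {M : Matrix n n ℂ} (hM : M.IsHermitian) :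
    negRootCount M = (Finset.univ.filter fun i => hM.eigenvalues i < 0).card := by
  rw [negRootCount, countP_roots_charpoly_eq_card hM]
  simp only [Complex.ofReal_re]

/-- For a Hermitian matrix the positive root count is the number of positive eigenvalues. -/
theorem posRootCount_eq_card {M : Matrix n n ℂ} (hM : M.IsHermitian) :
    posRootCount M = (Finset.univ.filter fun i => 0 < hM.eigenvalues i).card := by
  rw [posRootCount, countP_roots_charpoly_eq_card hM]
  simp only [Complex.ofReal_re]

/-- For a Hermitian matrix the zero root count is the number of zero eigenvalues (the nullity). -/
theorem zeroRootCount_eq_card {M : Matrix n n ℂ} (hM : M.IsHermitian) :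
    zeroRootCount M = (Finset.univ.filter fun i => hM.eigenvalues i = 0).card := by
  rw [zeroRootCount, countP_roots_charpoly_eq_card hM]
  simp only [Complex.ofReal_eq_zero]

/-- `neg + pos + zero = card n` for a Hermitian matrix. -/
theorem negRootCount_add_posRootCount_add_zeroRootCount {M : Matrix n n ℂ} (hM : M.IsHermitian) :
    negRootCount M + posRootCount M + zeroRootCount M = Fintype.card n := by
  rw [negRootCount_eq_card hM, posRootCount_eq_card hM, zeroRootCount_eq_card hM,
    Finset.card_filter, Finset.card_filter, Finset.card_filter, ← Finset.sum_add_distrib,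
    ← Finset.sum_add_distrib, ← Finset.card_univ, Finset.card_eq_sum_ones]
  refine Finset.sum_congr rfl fun i _ => ?_
  rcases lt_trichotomy (hM.eigenvalues i) 0 with h | h | h
  · rw [if_pos h, if_neg h.not_gt, if_neg h.ne]
  · rw [if_neg (by rw [h]; exact lt_irrefl 0), if_neg (by rw [h]; exact lt_irrefl 0), if_pos h]
  · rw [if_neg h.not_gt, if_pos h, if_neg h.ne']

/-- `neg + pos ≤ card n` for a Hermitian matrix. -/
theorem negRootCount_add_posRootCount_le {M : Matrix n n ℂ} (hM : M.IsHermitian) :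
    negRootCount M + posRootCount M ≤ Fintype.card n := by
  have := negRootCount_add_posRootCount_add_zeroRootCount hM
  omega

/-- **Local semicontinuity of the inertia along an affine Hermitian pencil.** For Hermitian `A`, `Γ`
with `|Re⟨v, Γ v⟩| ≤ ‖v‖²`, along `H(t) = A + t Γ`: near every `s`, the negative count cannot drop
and can rise by at most the nullity of `H(s)` — `n₋(H s) ≤ n₋(H t) ≤ n₋(H s) + n₀(H s)` for
`|t - s| < r(s)`, `r(s)` the smallest non-zero `|eigenvalue|` of `H(s)` (Sylvester's law of inertia on
the negative and positive eigenspaces of `H(s)`; no eigenvalue perturbation theory is used). -/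
theorem negRootCount_local {A Γ : Matrix n n ℂ} (hA : A.IsHermitian) (hΓ : Γ.IsHermitian)
    (hΓv : ∀ v : n → ℂ, |(star v ⬝ᵥ (Γ *ᵥ v)).re| ≤ ∑ i, ‖v i‖ ^ 2) (s : ℝ) :
    ∃ r : ℝ, 0 < r ∧ ∀ t : ℝ, |t - s| < r →
      negRootCount (A + ((s : ℝ) : ℂ) • Γ) ≤ negRootCount (A + ((t : ℝ) : ℂ) • Γ) ∧
        negRootCount (A + ((t : ℝ) : ℂ) • Γ) ≤
          negRootCount (A + ((s : ℝ) : ℂ) • Γ) + zeroRootCount (A + ((s : ℝ) : ℂ) • Γ) := by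
  set Hs : Matrix n n ℂ := A + ((s : ℝ) : ℂ) • Γ with hHs_def
  have hHs : Hs.IsHermitian := isHermitian_add_real_smul hA hΓ s
  set e : n → ℝ := hHs.eigenvalues with he
  set U : Matrix n n ℂ := (hHs.eigenvectorUnitary : Matrix n n ℂ) with hU
  have hUmem : U ∈ Matrix.unitaryGroup n ℂ := (hHs.eigenvectorUnitary).2
  -- the radius: smallest non-zero |eigenvalue| (or 1 if there is none)
  let S : Finset n := Finset.univ.filter fun i => e i ≠ 0
  let r : ℝ := if hS : S.Nonempty then S.inf' hS (fun i => |e i|) else 1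
  have hr : 0 < r := by
    simp only [r]
    split_ifs with hS
    · rw [Finset.lt_inf'_iff]
      intro i hi
      exact abs_pos.2 (Finset.mem_filter.1 hi).2
    · exact one_pos
  have hre : ∀ i, e i ≠ 0 → r ≤ |e i| := by
    intro i hi
    have hiS : i ∈ S := Finset.mem_filter.2 ⟨Finset.mem_univ _, hi⟩
    have hS : S.Nonempty := ⟨i, hiS⟩
    simp only [r, dif_pos hS]
    exact Finset.inf'_le (fun i => |e i|) hiS
  refine ⟨r, hr, fun t ht => ?_⟩
  set Ht : Matrix n n ℂ := A + ((t : ℝ) : ℂ) • Γ with hHt_def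
  have hHt : Ht.IsHermitian := isHermitian_add_real_smul hA hΓ t
  have hHts : Ht = Hs + (((t - s : ℝ)) : ℂ) • Γ := by
    simp only [hHt_def, hHs_def, Complex.ofReal_sub, sub_smul, add_assoc, add_sub_cancel]
  -- the form of `Ht` on a vector, split
  have hform : ∀ v : n → ℂ, (star v ⬝ᵥ (Ht *ᵥ v)).re =
      (star v ⬝ᵥ (Hs *ᵥ v)).re + (t - s) * (star v ⬝ᵥ (Γ *ᵥ v)).re := by
    intro v
    rw [hHts, add_mulVec, smul_mulVec, dotProduct_add, dotProduct_smul, Complex.add_re,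
      smul_eq_mul, Complex.re_ofReal_mul]
  -- the form of `Hs` on `U (ext c)` in eigen-coordinates
  have hformS : ∀ (p : n → Prop) [DecidablePred p] (c : {i // p i} → ℂ),
      (star (U *ᵥ extendByZero p c) ⬝ᵥ (Hs *ᵥ (U *ᵥ extendByZero p c))).re =
        ∑ i, e i * ‖extendByZero p c i‖ ^ 2 := by
    intro p _ c
    rw [re_form_eq_sum_eigenvalues hHs, ← hU, conjTranspose_mulVec_mulVec_of_mem_unitaryGroup hUmem]
  -- (i) the negative count cannot drop
  have hneg : negRootCount Hs ≤ negRootCount Ht := by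
    rw [negRootCount_eq_card hHs, negRootCount_eq_card hHt, ← Fintype.card_subtype]
    have h := card_le_card_eigenvalues_of_form_pos hHt (-1)
      ((Matrix.mulVecLin U) ∘ₗ extendByZero (fun i => e i < 0)) (fun c hc => ?_)
    · simpa only [neg_mul, one_mul, Left.neg_pos_iff] using h
    · simp only [LinearMap.coe_comp, Function.comp_apply, Matrix.mulVecLin_apply, neg_mul, one_mul,
        Left.neg_pos_iff]
      set v := U *ᵥ extendByZero (fun i => e i < 0) c with hv
      have hN2 : ∑ i, ‖v i‖ ^ 2 = ∑ i, ‖extendByZero (fun i => e i < 0) c i‖ ^ 2 :=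
        sum_norm_sq_mulVec_of_mem_unitaryGroup hUmem _
      have hN2pos : 0 < ∑ i, ‖extendByZero (fun i => e i < 0) c i‖ ^ 2 :=
        sum_norm_sq_pos (extendByZero_ne_zero hc)
      have h1 : (star v ⬝ᵥ (Hs *ᵥ v)).re ≤ -r * ∑ i, ‖extendByZero (fun i => e i < 0) c i‖ ^ 2 := by
        rw [hv, hformS, Finset.mul_sum]
        refine Finset.sum_le_sum fun i _ => ?_
        by_cases hi : e i < 0
        · have := hre i hi.ne
          rw [abs_of_neg hi] at this
          have h0 : 0 ≤ ‖extendByZero (fun i => e i < 0) c i‖ ^ 2 := by positivity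
          nlinarith
        · rw [extendByZero_apply_of_neg c hi, norm_zero]; simp
      have h2 : (t - s) * (star v ⬝ᵥ (Γ *ᵥ v)).re ≤ |t - s| * ∑ i, ‖v i‖ ^ 2 := by
        calc (t - s) * (star v ⬝ᵥ (Γ *ᵥ v)).re ≤ |(t - s) * (star v ⬝ᵥ (Γ *ᵥ v)).re| := le_abs_self _
          _ = |t - s| * |(star v ⬝ᵥ (Γ *ᵥ v)).re| := abs_mul _ _
          _ ≤ |t - s| * ∑ i, ‖v i‖ ^ 2 := mul_le_mul_of_nonneg_left (hΓv v) (abs_nonneg _)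
      rw [hform, hN2] at *
      nlinarith
  -- (ii) the positive count cannot drop
  have hpos : posRootCount Hs ≤ posRootCount Ht := by
    rw [posRootCount_eq_card hHs, posRootCount_eq_card hHt, ← Fintype.card_subtype]
    have h := card_le_card_eigenvalues_of_form_pos hHt 1
      ((Matrix.mulVecLin U) ∘ₗ extendByZero (fun i => 0 < e i)) (fun c hc => ?_)
    · simpa only [one_mul] using h
    · simp only [LinearMap.coe_comp, Function.comp_apply, Matrix.mulVecLin_apply, one_mul]
      set v := U *ᵥ extendByZero (fun i => 0 < e i) c with hv
      have hN2 : ∑ i, ‖v i‖ ^ 2 = ∑ i, ‖extendByZero (fun i => 0 < e i) c i‖ ^ 2 :=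
        sum_norm_sq_mulVec_of_mem_unitaryGroup hUmem _
      have hN2pos : 0 < ∑ i, ‖extendByZero (fun i => 0 < e i) c i‖ ^ 2 :=
        sum_norm_sq_pos (extendByZero_ne_zero hc)
      have h1 : r * ∑ i, ‖extendByZero (fun i => 0 < e i) c i‖ ^ 2 ≤ (star v ⬝ᵥ (Hs *ᵥ v)).re := by
        rw [hv, hformS, Finset.mul_sum]
        refine Finset.sum_le_sum fun i _ => ?_
        by_cases hi : 0 < e i
        · have := hre i hi.ne'
          rw [abs_of_pos hi] at this
          have h0 : 0 ≤ ‖extendByZero (fun i => 0 < e i) c i‖ ^ 2 := by positivity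
          nlinarith
        · rw [extendByZero_apply_of_neg c hi, norm_zero]; simp
      have h2 : -(|t - s| * ∑ i, ‖v i‖ ^ 2) ≤ (t - s) * (star v ⬝ᵥ (Γ *ᵥ v)).re := by
        rw [neg_le]
        calc -((t - s) * (star v ⬝ᵥ (Γ *ᵥ v)).re) ≤ |(t - s) * (star v ⬝ᵥ (Γ *ᵥ v)).re| :=
            neg_le_abs _
          _ = |t - s| * |(star v ⬝ᵥ (Γ *ᵥ v)).re| := abs_mul _ _
          _ ≤ |t - s| * ∑ i, ‖v i‖ ^ 2 := mul_le_mul_of_nonneg_left (hΓv v) (abs_nonneg _)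
      rw [hform, hN2] at *
      nlinarith
  -- (iii) bookkeeping
  have h3 := negRootCount_add_posRootCount_le hHt
  have h4 := negRootCount_add_posRootCount_add_zeroRootCount hHs
  exact ⟨hneg, by omega⟩

/-- **The nullity along the pencil is at most the algebraic multiplicity of the real eigenvalue.**
With `Γ² = 1`, `Γ (A + s Γ) = Γ A + s`, so `n₀(A + sΓ) = dim ker (ΓA + s) ≤ mult_{-s}(charpoly (Γ A))`
(geometric ≤ algebraic multiplicity, Mathlib `LinearMap.finrank_eigenspace_le`). -/
theorem zeroRootCount_le_count {A Γ : Matrix n n ℂ} (hA : A.IsHermitian) (hΓ : Γ.IsHermitian)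
    (hΓ2 : Γ * Γ = 1) (s : ℝ) :
    zeroRootCount (A + ((s : ℝ) : ℂ) • Γ) ≤ (Γ * A).charpoly.roots.count (((-s : ℝ) : ℂ)) := by
  set Hs : Matrix n n ℂ := A + ((s : ℝ) : ℂ) • Γ with hHs_def
  have hHs : Hs.IsHermitian := isHermitian_add_real_smul hA hΓ s
  -- nullity = card n - rank
  have hz : zeroRootCount Hs + Hs.rank = Fintype.card n := by
    rw [zeroRootCount_eq_card hHs, hHs.rank_eq_card_non_zero_eigs, Fintype.card_subtype]
    exact Finset.card_filter_add_card_filter_not _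
  -- rank is invariant under left multiplication by the involution `Γ`
  have hunit : IsUnit Γ.det := by
    have h : Γ.det * Γ.det = 1 := by rw [← det_mul, hΓ2, det_one]
    exact IsUnit.of_mul_eq_one _ h
  have hrank : Hs.rank = (Γ * A + ((s : ℝ) : ℂ) • (1 : Matrix n n ℂ)).rank := by
    rw [← rank_mul_eq_right_of_isUnit_det Γ Hs hunit, hHs_def, mul_add, Matrix.mul_smul, hΓ2]
  -- rank-nullity for `M = ΓA + s`
  set M : Matrix n n ℂ := Γ * A + ((s : ℝ) : ℂ) • (1 : Matrix n n ℂ) with hM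
  have hrn : M.rank + Module.finrank ℂ (LinearMap.ker M.mulVecLin) = Fintype.card n := by
    rw [Matrix.rank, LinearMap.finrank_range_add_finrank_ker, Module.finrank_fintype_fun_eq_card]
  -- the kernel is the eigenspace of `ΓA` at `-s`
  have hker : LinearMap.ker M.mulVecLin =
      Module.End.eigenspace (Matrix.toLin' (Γ * A)) (((-s : ℝ) : ℂ)) := by
    ext v
    rw [LinearMap.mem_ker, Module.End.mem_eigenspace_iff, Matrix.mulVecLin_apply, Matrix.toLin'_apply,
      hM, add_mulVec, smul_mulVec, one_mulVec, Complex.ofReal_neg, neg_smul, ← eq_neg_iff_add_eq_zero]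
  have hle : Module.finrank ℂ (LinearMap.ker M.mulVecLin) ≤
      (Γ * A).charpoly.roots.count (((-s : ℝ) : ℂ)) := by
    rw [hker, Polynomial.count_roots, ← Matrix.charpoly_toLin']
    exact LinearMap.finrank_eigenspace_le _ _
  omega

end IndexBudgetMatrix

end Summit.QuantumFields.QCD.Theorems.ExtinctionBuildsQCD.Negative

end
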